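import Literature.Geometry.Lorentzian.KerrCylinderSecondOrder
import Literature.Geometry.Lorentzian.KerrSpinVectorFirstOrder
import HarnessLib

/-!
# First-order expansion of the four-parameter Kerr cylinder family in `p = (δm, b⃗)`

Support file (all results proved; no named facts) for the named fact `LiMei.interiorKerrGluing`
(`InteriorKerrGluing.lean`; J. Li, H. Mei, *A construction of collapsing spacetimes in vacuum*,
Comm. Math. Phys. 378 (2020) = arXiv:2005.01249, Prop. 4.1). The reduction
`LiMei.interiorKerrGluing_of_core` (`InteriorKerrGluingReduction.lean`) glues in the Kerr cylinder
data with parameters `(m, a, R) = (M + p.1, ‖p.2‖, spinIsometry p.2)`, `p = (δm, b⃗) ∈ ℝ × ℝ³`,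
and its degree argument needs this family to be differentiable at `p = 0` with an explicit, in
`b⃗` LINEAR, differential and a uniform `O(‖p‖²)` remainder (Li–Mei p. 25:
`𝓘 = (8π(m − m₀), −8π m₀ a⃗) + O(ε) + O(|p|²)`). Combining the second-order expansion in `(m, a)`
(`KerrCylinderSecondOrder.lean`) with the linearity of the first-order spin terms in the spin vector
(`KerrSpinVectorFirstOrder.lean`, `‖b‖((Ry)₁(Rv)₀ − (Ry)₀(Rv)₁) = −b·(y × v)`), this file proves,
uniformly for `ρ₁ < ‖y‖ < ρ₂` (`ρ₁ ≥ 1`) and unit `v, w`: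

* `LiMei.exists_abs_cylH_family_le` —
  `|H[M + δm, ‖b‖, R_b](y)(v,w) − ḡ_M(y)(v,w) − δm (2/r₀) dt²(v,w)
     + (2M/(r₀‖y‖³))(b·(y × v)⟪y,w⟫ + ⟪y,v⟫ b·(y × w))| ≤ C (|δm| + ‖b‖)²`;
* `LiMei.exists_abs_cylK_family_le` — the same for the second fundamental form, with
  `∂_m k̄_M` and the coefficient `M(2M/r₀ − 1)^{1/2}/(r₀²‖y‖³)`.

## References

* J. Li, H. Mei, arXiv:2005.01249, §4, (4.2) and p. 25 (key `LiMei2020`).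
-/

noncomputable section

open Set Filter Function Metric
open scoped Topology RealInnerProductSpace

namespace Literature.Geometry.Lorentzian

namespace LiMei

/-- `b·(y × v)` vanishes at `b = 0`. [folklore] -/
theorem triple_zero_left (y v : E3) : triple 0 y v = 0 := by
  rw [triple_eq]
  simp

/-- **First-order expansion of the metric of the four-parameter Kerr cylinder family at `p = 0`**,
with a differential linear in `p = (δm, b)` and a uniform quadratic remainder. [cite: LiMei2020, p. 25] -/
theorem exists_abs_cylH_family_le (M : ℝ) {r₀ : ℝ} (hr₀ : 0 < r₀) {ρ₁ : ℝ} (hρ₁ : 1 ≤ ρ₁)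
    (ρ₂ τ₀ : ℝ) :
    ∃ C : ℝ, 0 ≤ C ∧ ∀ p : ℝ × E3, |p.1| + ‖p.2‖ ≤ 1 → ∀ (v w : E3), ‖v‖ ≤ 1 → ‖w‖ ≤ 1 →
      ∀ y : E3, ρ₁ < ‖y‖ → ‖y‖ < ρ₂ →
        |cylH (M + p.1) ‖p.2‖ r₀ τ₀ (spinIsometry p.2) y v w - gbarRep M r₀ y v w -
            p.1 * (2 / r₀ * (⟪y, v⟫ * ⟪y, w⟫ / ‖y‖ ^ 2)) +
            2 * M / (r₀ * ‖y‖ ^ 3) * (triple p.2 y v * ⟪y, w⟫ + ⟪y, v⟫ * triple p.2 y w)| ≤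
          C * (|p.1| + ‖p.2‖) ^ 2 := by
  obtain ⟨C, hC0, hC⟩ := exists_abs_cylH_taylor₂_le M hr₀ hρ₁ ρ₂ τ₀
  refine ⟨C, hC0, fun p hp v w hv hw y hy₁ hy₂ ↦ ?_⟩
  have hma : |M + p.1 - M| + |‖p.2‖| ≤ 1 := by
    rw [add_sub_cancel_left, abs_norm]; exact hp
  have h := hC (M + p.1) ‖p.2‖ hma (spinIsometry p.2) v w hv hw y hy₁ hy₂
  rw [add_sub_cancel_left, abs_norm] at h
  by_cases hb : p.2 = 0
  · -- zero spin: the family is the exact Schwarzschild cylinder, the `b`-term vanishes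
    rw [hb, norm_zero, spinIsometry_zero] at h
    rw [hb, triple_zero_left, triple_zero_left, norm_zero]
    simpa using h
  · -- nonzero spin: the first-order spin term is `−(2M/(r₀‖y‖³))(b·(y×v)⟪y,w⟫ + ⟪y,v⟫ b·(y×w))`
    rw [norm_mul_firstOrderH_spinIsometry M r₀ hb y v w] at h
    convert h using 2
    ring

/-- **First-order expansion of the second fundamental form of the four-parameter Kerr cylinder
family at `p = 0`** (`0 < r₀ < 2M`), with a differential linear in `p = (δm, b)` and a uniform
quadratic remainder. [cite: LiMei2020, p. 25] -/
theorem exists_abs_cylK_family_le [Kerr.Facts] {M r₀ : ℝ} (hr₀ : 0 < r₀) (h2M : r₀ < 2 * M)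
    {ρ₁ : ℝ} (hρ₁ : 1 ≤ ρ₁) (ρ₂ τ₀ : ℝ) :
    ∃ δ C : ℝ, 0 < δ ∧ 0 ≤ C ∧ ∀ p : ℝ × E3, |p.1| + ‖p.2‖ ≤ δ → ∀ (v w : E3), ‖v‖ ≤ 1 → ‖w‖ ≤ 1 →
      ∀ y : E3, ρ₁ < ‖y‖ → ‖y‖ < ρ₂ →
        |cylK (M + p.1) ‖p.2‖ hr₀ τ₀ (spinIsometry p.2) y v w - kbarRep M r₀ y v w -
            p.1 * ((Real.sqrt (2 * M / r₀ - 1) / r₀ ^ 2 + M / (r₀ ^ 3 * Real.sqrt (2 * M / r₀ - 1))) *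
                (⟪y, v⟫ * ⟪y, w⟫ / ‖y‖ ^ 2) -
              1 / (Real.sqrt (2 * M / r₀ - 1) * ‖y‖ ^ 2) * (⟪v, w⟫ - ⟪y, v⟫ * ⟪y, w⟫ / ‖y‖ ^ 2)) +
            M * Real.sqrt (2 * M / r₀ - 1) / (r₀ ^ 2 * ‖y‖ ^ 3) *
              (triple p.2 y v * ⟪y, w⟫ + ⟪y, v⟫ * triple p.2 y w)| ≤
          C * (|p.1| + ‖p.2‖) ^ 2 := by
  obtain ⟨δ, C, hδ, hC0, hC⟩ := exists_abs_cylK_taylor₂_le hr₀ h2M hρ₁ ρ₂ τ₀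
  refine ⟨δ, C, hδ, hC0, fun p hp v w hv hw y hy₁ hy₂ ↦ ?_⟩
  have hma : |M + p.1 - M| + |‖p.2‖| ≤ δ := by
    rw [add_sub_cancel_left, abs_norm]; exact hp
  have h := hC (M + p.1) ‖p.2‖ hma (spinIsometry p.2) v w hv hw y hy₁ hy₂
  rw [add_sub_cancel_left, abs_norm] at h
  by_cases hb : p.2 = 0
  · rw [hb, norm_zero, spinIsometry_zero] at h
    rw [hb, triple_zero_left, triple_zero_left, norm_zero]
    simpa using h
  · rw [norm_mul_firstOrderK_spinIsometry M r₀ hb y v w] at h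
    convert h using 2
    ring

end LiMei

end Literature.Geometry.Lorentzian

end
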